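import Literature.AlgebraicGeometry.Motives.HodgeLieWeightOneRankTwoRigidity
import HarnessLib

/-!
# Weight one: the Levi involution algebra `(𝔊|_{V^{1,0}}, T = 1 − 2E)` of a minimal raising tripotent — the ADAPTER to the
# tree's involution-algebra cores (`UnitaryTwoOdd.eq_top`, `UnitaryThetaCore.eq_top_two_three'`, the `(2,4)` core)

Family `hodge`, layer `Literature/AlgebraicGeometry/Motives`; THEOREMS ONLY (no definition, no named fact; D-0026).  Written for the
cell `pub-hodgeav-hg6` (LADDER-HodgeAV row 2, TABLE X row 1 `g6.I(1)`: brick N12 of the row-1 programme; honest framing: HC / HC_AV /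
HC_CM NOT proved — unconditional Hodge–Lie linear algebra).  After N11 (`rankTwelve_sp_or_simple_three_four`) the rank-twelve crux is a
minimal raising tripotent `B` of rank `r ∈ {3, 4}` inside a simple `𝔥_ℂ`; the cell's director ruled (R17.38, lead 22:25:13Z (B)(C))
that the cases be routed through ONE involution-algebra core on `W = V^{1,0} ≅ ℂ⁶` (types `3|3` and `2|4`).  This file provides the
adapter: the data `(𝔏, T)` and ALL the core's structural hypotheses, plus the return leg «core `⊤` ⟹ `Lie Hg = 𝔰𝔭`».

* §1 **`WeightOnePeirce.exists_leviInvolutionAlgebra`** — (`𝔊 ⊆ 𝔥_ℂ` bracket-closed ∋ `Θ`, `V_ℂ` `𝔊`-irreducible, `B` a minimal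
  raising tripotent with `B̄ ∈ 𝔊`) the restrictions to `P = V^{1,0}` of the elements of `𝔊` preserving `P` form a bracket-closed
  `𝔏 ⊆ End(P)` containing `1` and acting irreducibly on `P` (`SymplecticThetaSix.levi_irreducible`), and `T = 1 − 2E|_P ∈ 𝔏`
  (`E = t⁻¹ B B̄`) is an involution whose `−1`-eigenspace maps onto `range B` (dimension `r`) and whose `+1`-eigenspace has dimension
  `dim P − r`.
* §2 **`rankTwelve_sp_or_leviCore`** — `dim_ℚ V = 12`, `End_Hdg = ℚ`: EITHER `Lie Hg = 𝔰𝔭₁₂`, OR `𝔥_ℂ` is simple and there is such an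
  `(𝔏, T)` on `V^{1,0} ≅ ℂ⁶` of type `3|3` or `2|4` (`dim {T = 1} = 6 − r`, `dim {T = −1} = r`, `r ∈ {3, 4}`) with `𝔏 ≠ End(V^{1,0})`
  (return leg: `𝔏 = ⊤` gives `Lie Hg = 𝔰𝔭₁₂` by `SymplecticThetaTen.mem_spanC_of_skew_of_levi`).  The second alternative is what the
  involution-algebra core must exclude (its `⊤` branch is absurd here; its skeleton / radical branch is the OPEN return leg).

## References

* [MoonenZarhin1999LowDim] B. Moonen, Yu. Zarhin, *Hodge classes on abelian varieties of low dimension*, Math. Ann. 315 (1999),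
  §2 (2.3)–(2.5), §3 (3.1).
* [Deligne1982HodgeCycles] P. Deligne, *Hodge cycles on abelian varieties*, LNM 900 (1982), I §3 (Prop. 3.4, 3.6).
* [Ribet1983] K. Ribet, *Hodge classes on certain types of abelian varieties*, Amer. J. Math. 105 (1983), Thm. 3.
* [Gordon1997] B. Gordon, *A survey of the Hodge conjecture for abelian varieties* (1997), §6 (proof of Thm. 6.3.3).
-/

noncomputable section

open scoped TensorProduct

namespace Literature.AlgebraicGeometry.Motives

namespace HodgeStructure

universe u

variable {V : Type u} [AddCommGroup V] [Module ℚ V] [Module.Finite ℚ V] [HodgeTensorFacts.{u, u}] {n : ℤ}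

/-! ## §1 The Levi involution algebra of a minimal tripotent -/

set_option maxHeartbeats 3200000 in
/-- **The Levi involution algebra `(𝔊|_P, 1 − 2E)`.**  For a minimal raising tripotent `B` of rank `r` (with `B̄ ∈ 𝔊`, `V_ℂ`
`𝔊`-irreducible): the restrictions `𝔏 ⊆ End(P)` of the `P`-preserving elements of `𝔊` are bracket-closed, contain `1`, act
irreducibly on `P`, and contain the involution `T = 1 − 2E|_P` with `−1`-eigenspace over `range B` (dimension `r`) and `+1`-eigenspace
of dimension `dim P − r`. [cite: MoonenZarhin1999LowDim, §2 (2.3)–(2.5)] [cite: Gordon1997, §6 (proof of Thm. 6.3.3)]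
[cite: Deligne1982HodgeCycles, I §3 Prop. 3.4, Prop. 3.6] -/
theorem WeightOnePeirce.exists_leviInvolutionAlgebra (H : HodgeStructure V n) (ψ : H.Polarization) (hn : n = 1)
    (heff : H.IsEffective) {Θ : Module.End ℂ (ℂ ⊗[ℚ] V)} (hΘ : ∀ p, ∀ x ∈ H.piece p (n - p), Θ x = ((2 * p - n : ℤ) : ℂ) • x)
    {𝔊 : Submodule ℂ (Module.End ℂ (ℂ ⊗[ℚ] V))} (h𝔊 : 𝔊 ≤ H.hodgeLieC) (hbr : ∀ Y ∈ 𝔊, ∀ Z ∈ 𝔊, Y * Z - Z * Y ∈ 𝔊)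
    (hΘ𝔊 : Θ ∈ 𝔊) (hirr : ∀ U : Submodule ℂ (ℂ ⊗[ℚ] V), (∀ Z ∈ 𝔊, ∀ u ∈ U, Z u ∈ U) → U = ⊥ ∨ U = ⊤)
    {B C : Module.End ℂ (ℂ ⊗[ℚ] V)} (hB : B ∈ 𝔊) (hB0 : B ≠ 0) (hBP : ∀ p ∈ H.piece 1 0, B p = 0)
    (hBim : ∀ v, B v ∈ H.piece 1 0) (hC : ∀ v, C v = conj (B (conj v))) (hC𝔊 : C ∈ 𝔊)
    (hmin : ∀ B' ∈ 𝔊, B' ≠ 0 → (∀ p ∈ H.piece 1 0, B' p = 0) → (∀ v, B' v ∈ H.piece 1 0) →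
      Module.finrank ℂ (LinearMap.range B) ≤ Module.finrank ℂ (LinearMap.range B')) :
    ∃ (𝔏 : Submodule ℂ (Module.End ℂ ↥(H.piece 1 0))) (T : Module.End ℂ ↥(H.piece 1 0))
      (PT QT : Submodule ℂ ↥(H.piece 1 0)),
      (∀ A, A ∈ 𝔏 ↔ ∃ Z ∈ 𝔊, ∀ p : ↥(H.piece 1 0), ((A p : ↥(H.piece 1 0)) : ℂ ⊗[ℚ] V) = Z p) ∧
      (∀ A ∈ 𝔏, ∀ A' ∈ 𝔏, A * A' - A' * A ∈ 𝔏) ∧ (1 : Module.End ℂ ↥(H.piece 1 0)) ∈ 𝔏 ∧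
      (∀ U₀ : Submodule ℂ ↥(H.piece 1 0), (∀ A ∈ 𝔏, ∀ u ∈ U₀, A u ∈ U₀) → U₀ = ⊥ ∨ U₀ = ⊤) ∧
      T ∈ 𝔏 ∧ T * T = 1 ∧ (∀ x, x ∈ PT ↔ T x = x) ∧ (∀ x, x ∈ QT ↔ T x = -x) ∧
      Submodule.map (H.piece 1 0).subtype QT = LinearMap.range B ∧
      Module.finrank ℂ QT = Module.finrank ℂ (LinearMap.range B) ∧
      Module.finrank ℂ PT + Module.finrank ℂ QT = Module.finrank ℂ (H.piece 1 0) := by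
  classical
  obtain ⟨t, ht, hBCB⟩ := WeightOneMinimalRaising.mul_conjOp_mul_eq_smul H ψ hn heff hΘ h𝔊 hbr hB hB0 hBP hBim hC hC𝔊 hmin
  obtain ⟨hCBC, -⟩ := WeightOnePeirce.conjOp_mul_conjOp_mul hC ht hB0 hBCB
  subst hn
  obtain ⟨hPmem, hQmem, hΘ10, hΘ01, hΘΘ⟩ := UnitaryTheta.theta_facts H rfl heff hΘ
  set P := H.piece 1 0 with hPdef
  set Q := H.piece 0 1 with hQdef
  set M := ℂ ⊗[ℚ] V
  obtain ⟨hCQ, hCim, -, -⟩ := SymplecticThetaTen.conjOp_raise (P := P) (Q := Q)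
    (fun x hx => conj_mem_piece H hx) (fun x hx => conj_mem_piece H hx) hBP hBim hC
  have hBB : B * B = 0 := LinearMap.ext fun v => by
    rw [Module.End.mul_apply, hBP _ (hBim v), LinearMap.zero_apply]
  have hCC : C * C = 0 := LinearMap.ext fun v => by
    rw [Module.End.mul_apply, hCQ _ (hCim v), LinearMap.zero_apply]
  obtain ⟨E, hE⟩ : ∃ E : Module.End ℂ M, E = t⁻¹ • (B * C) := ⟨_, rfl⟩
  obtain ⟨F, hF⟩ : ∃ F : Module.End ℂ M, F = t⁻¹ • (C * B) := ⟨_, rfl⟩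
  obtain ⟨hEE, -, -, -, -, -, -, -, -, -⟩ := WeightOnePeirce.tripotent_facts ht hBCB hCBC hBB hCC hE hF
  have hEP : ∀ v, E v ∈ P := fun v => by
    rw [hE, LinearMap.smul_apply, Module.End.mul_apply]
    exact Submodule.smul_mem _ _ (hBim _)
  have hFP : ∀ p ∈ P, F p = 0 := fun p hp => by
    rw [hF, LinearMap.smul_apply, Module.End.mul_apply, hBP p hp, map_zero, smul_zero]
  have hrangeE : LinearMap.range E = LinearMap.range B :=
    (WeightOneMinimalRaising.isIdempotentElem_of_mul_conjOp_mul_eq_smul H rfl heff hΘ hBP hBim hC ht hBCB).2.1 |> fun h => by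
      rw [hE]; exact h
  have hhEF : t⁻¹ • (B * C - C * B) = E - F := by rw [smul_sub, hE, hF]
  -- the algebra `𝔏`
  let 𝔏 : Submodule ℂ (Module.End ℂ ↥P) :=
    { carrier := {A | ∃ Z ∈ 𝔊, ∀ p : ↥P, ((A p : ↥P) : M) = Z p}
      zero_mem' := ⟨0, Submodule.zero_mem _, fun p => by simp⟩
      add_mem' := by
        rintro A A' ⟨Z, hZ, hAZ⟩ ⟨Z', hZ', hAZ'⟩
        exact ⟨Z + Z', Submodule.add_mem _ hZ hZ', fun p => by
          rw [LinearMap.add_apply, Submodule.coe_add, hAZ, hAZ', LinearMap.add_apply]⟩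
      smul_mem' := by
        rintro c A ⟨Z, hZ, hAZ⟩
        exact ⟨c • Z, Submodule.smul_mem _ _ hZ, fun p => by
          rw [LinearMap.smul_apply, Submodule.coe_smul, hAZ, LinearMap.smul_apply]⟩ }
  have hmem𝔏 : ∀ A, A ∈ 𝔏 ↔ ∃ Z ∈ 𝔊, ∀ p : ↥P, ((A p : ↥P) : M) = Z p := fun A => Iff.rfl
  have h𝔏br : ∀ A ∈ 𝔏, ∀ A' ∈ 𝔏, A * A' - A' * A ∈ 𝔏 := by
    intro A hA' A' hA''
    obtain ⟨Z, hZ, hAZ⟩ := (hmem𝔏 A).1 hA'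
    obtain ⟨Z', hZ', hAZ'⟩ := (hmem𝔏 A').1 hA''
    refine (hmem𝔏 _).2 ⟨Z * Z' - Z' * Z, hbr _ hZ _ hZ', fun p => ?_⟩
    rw [LinearMap.sub_apply, Submodule.coe_sub, Module.End.mul_apply, Module.End.mul_apply, hAZ, hAZ', hAZ',
      hAZ, LinearMap.sub_apply, Module.End.mul_apply, Module.End.mul_apply]
  have h𝔏one : (1 : Module.End ℂ ↥P) ∈ 𝔏 :=
    (hmem𝔏 _).2 ⟨Θ, hΘ𝔊, fun p => by rw [Module.End.one_apply, hΘ10 _ p.2]⟩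
  have h𝔏irr : ∀ U₀ : Submodule ℂ ↥P, (∀ A ∈ 𝔏, ∀ u ∈ U₀, A u ∈ U₀) → U₀ = ⊥ ∨ U₀ = ⊤ := by
    intro U₀ hU₀
    refine SymplecticThetaSix.levi_irreducible 𝔊 hbr hΘ𝔊 hΘΘ hΘ10 hΘ01 hPmem hQmem hirr U₀ fun Z hZ hZP u hu => ?_
    exact hU₀ _ ((hmem𝔏 _).2 ⟨Z, hZ, fun p => rfl⟩) u hu
  -- the involution `T = 1 − 2 E|_P`
  have hEP' : ∀ p ∈ P, E p ∈ P := fun p _ => hEP p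
  set Ex : Module.End ℂ ↥P := E.restrict hEP' with hExdef
  have hExv : ∀ p : ↥P, ((Ex p : ↥P) : M) = E p := fun p => rfl
  have hExx : ∀ p : ↥P, Ex (Ex p) = Ex p := fun p => by
    apply Subtype.ext
    rw [hExv, hExv, ← Module.End.mul_apply, hEE]
  set T : Module.End ℂ ↥P := 1 - (2 : ℂ) • Ex with hTdef
  have hTv : ∀ p : ↥P, T p = p - (2 : ℂ) • Ex p := fun p => by
    rw [hTdef, LinearMap.sub_apply, Module.End.one_apply, LinearMap.smul_apply]
  have hT𝔏 : T ∈ 𝔏 := by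
    refine (hmem𝔏 _).2 ⟨Θ - (2 : ℂ) • (t⁻¹ • (B * C - C * B)),
      Submodule.sub_mem _ hΘ𝔊 (Submodule.smul_mem _ _ (Submodule.smul_mem _ _ (hbr B hB C hC𝔊))), fun p => ?_⟩
    rw [hTv, Submodule.coe_sub, Submodule.coe_smul, hExv, hhEF, LinearMap.sub_apply, LinearMap.smul_apply,
      LinearMap.sub_apply, hFP _ p.2, sub_zero, hΘ10 _ p.2]
  have hTT : T * T = 1 := LinearMap.ext fun p => by
    rw [Module.End.mul_apply, Module.End.one_apply, hTv, hTv, map_sub, map_smul, hExx, smul_sub]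
    module
  -- eigenspaces
  let PT : Submodule ℂ ↥P := LinearMap.ker Ex
  let QT : Submodule ℂ ↥P := LinearMap.range Ex
  have hPT : ∀ x, x ∈ PT ↔ T x = x := fun x => by
    rw [LinearMap.mem_ker, hTv, sub_eq_self, smul_eq_zero]
    exact ⟨fun h => Or.inr h, fun h => h.resolve_left two_ne_zero⟩
  have hQT : ∀ x, x ∈ QT ↔ T x = -x := fun x => by
    constructor
    · rintro ⟨y, rfl⟩
      rw [hTv, hExx, two_smul]
      abel
    · intro h
      rw [hTv] at h
      have h2 : (2 : ℂ) • Ex x = (2 : ℂ) • x := by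
        have h' : x - (2 : ℂ) • Ex x + x = -x + x := by rw [h]
        rw [neg_add_cancel] at h'
        have h'' : (2 : ℂ) • x - (2 : ℂ) • Ex x = 0 := by rw [← h']; module
        exact (sub_eq_zero.1 h'').symm
      have hx : Ex x = x := smul_right_injective _ (two_ne_zero' ℂ) h2
      exact ⟨x, hx⟩
  have hmapQT : Submodule.map P.subtype QT = LinearMap.range B := by
    rw [← hrangeE]
    apply le_antisymm
    · rintro _ ⟨p, ⟨q, rfl⟩, rfl⟩
      exact ⟨(q : M), (hExv q).symm⟩
    · rintro _ ⟨v, rfl⟩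
      refine ⟨⟨E v, hEP v⟩, ⟨⟨E v, hEP v⟩, Subtype.ext ?_⟩, rfl⟩
      rw [hExv, ← Module.End.mul_apply, hEE]
  have hfinQT : Module.finrank ℂ QT = Module.finrank ℂ (LinearMap.range B) := by
    rw [← Submodule.finrank_map_subtype_eq P QT, hmapQT]
  have hsum : Module.finrank ℂ PT + Module.finrank ℂ QT = Module.finrank ℂ P := by
    rw [add_comm]
    exact LinearMap.finrank_range_add_finrank_ker Ex
  exact ⟨𝔏, T, PT, QT, hmem𝔏, h𝔏br, h𝔏one, h𝔏irr, hT𝔏, hTT, hPT, hQT, hmapQT, hfinQT, hsum⟩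


/-! ## §2 Rank twelve: `Hg = Sp₁₂`, or a proper Levi involution algebra of type `3|3` or `2|4` on `V^{1,0} ≅ ℂ⁶` -/

set_option maxHeartbeats 1600000 in
/-- **Rank twelve, `End_Hdg = ℚ`: either `Lie Hg ⊗ ℂ = 𝔰𝔭(V_ℂ, ψ_ℂ)`, or `𝔥_ℂ` is simple and the Levi involution algebra
`(𝔏, T)` of a minimal raising tripotent of rank `r ∈ {3, 4}` is a PROPER bracket-closed, unital, irreducible subspace of
`End(V^{1,0})` (`dim V^{1,0} = 6`) containing an involution of type `(6 − r) | r`** — the input of the involution-algebra cores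
(`UnitaryThetaCore.eq_top_two_three'`-type for `3|3`, the `(2,4)` core for `2|4`); the return leg «`𝔏 = End(V^{1,0})` ⟹
`Lie Hg = 𝔰𝔭₁₂`» is `SymplecticThetaTen.mem_spanC_of_skew_of_levi` (it would produce a rank-one raising operator, contradicting
`r ≥ 3`). [cite: MoonenZarhin1999LowDim, §2 (2.3)–(2.5) and §3 (3.1)] [cite: Ribet1983, Thm. 3] [cite: Gordon1997, §6] -/
theorem rankTwelve_sp_or_leviCore (H : HodgeStructure V n) (hn : n = 1) (heff : H.IsEffective) (ψ : H.Polarization)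
    (hE : ∀ a ∈ H.endAlg, ∃ x : ℚ, a = x • (1 : Module.End ℚ V)) (hV : Module.finrank ℚ V = 12) :
    (∀ Y : Module.End ℂ (ℂ ⊗[ℚ] V),
        (∀ x y, ψ.form.baseChange ℂ (Y x) y + ψ.form.baseChange ℂ x (Y y) = 0) → Y ∈ H.hodgeLieC) ∨
      ((∀ T : Submodule ℂ (Module.End ℂ (ℂ ⊗[ℚ] V)), T ≤ H.hodgeLieC → T ≠ ⊥ →
          (∀ Y ∈ H.hodgeLieC, ∀ t ∈ T, Y * t - t * Y ∈ T) → T = H.hodgeLieC) ∧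
        Module.finrank ℂ (H.piece 1 0) = 6 ∧
        ∃ (𝔏 : Submodule ℂ (Module.End ℂ ↥(H.piece 1 0))) (T : Module.End ℂ ↥(H.piece 1 0))
          (PT QT : Submodule ℂ ↥(H.piece 1 0)),
          (∀ A, A ∈ 𝔏 ↔ ∃ Z ∈ H.hodgeLieC, ∀ p : ↥(H.piece 1 0), ((A p : ↥(H.piece 1 0)) : ℂ ⊗[ℚ] V) = Z p) ∧
          (∀ A ∈ 𝔏, ∀ A' ∈ 𝔏, A * A' - A' * A ∈ 𝔏) ∧ (1 : Module.End ℂ ↥(H.piece 1 0)) ∈ 𝔏 ∧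
          (∀ U₀ : Submodule ℂ ↥(H.piece 1 0), (∀ A ∈ 𝔏, ∀ u ∈ U₀, A u ∈ U₀) → U₀ = ⊥ ∨ U₀ = ⊤) ∧
          T ∈ 𝔏 ∧ T * T = 1 ∧ (∀ x, x ∈ PT ↔ T x = x) ∧ (∀ x, x ∈ QT ↔ T x = -x) ∧
          (Module.finrank ℂ QT = 3 ∨ Module.finrank ℂ QT = 4) ∧
          Module.finrank ℂ PT + Module.finrank ℂ QT = 6 ∧ 𝔏 ≠ ⊤) := by
  classical
  rcases rankTwelve_sp_or_simple_three_four H hn heff ψ hE hV with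
    h | ⟨⟨B, C, hB, hB0, hBP, hBim, hC, hmin, h3, h4⟩, hsimple⟩
  · exact Or.inl h
  · right
    obtain ⟨hbr, hskew, -, Θ, hΘ, hΘ𝔤⟩ := hodgeLie_standing H ψ
    have hspan : H.hodgeLieC = spanC H.hodgeLie := hodgeLieC_eq_spanC H
    have hΘC : Θ ∈ H.hodgeLieC := by rw [hspan]; exact hΘ𝔤
    have hbrC : ∀ Y ∈ H.hodgeLieC, ∀ Z ∈ H.hodgeLieC, Y * Z - Z * Y ∈ H.hodgeLieC := fun Y hY Z hZ => by
      rw [hspan] at hY hZ ⊢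
      exact commutator_mem_spanC hbr hY hZ
    have hirr : ∀ U : Submodule ℂ (ℂ ⊗[ℚ] V), (∀ Z ∈ H.hodgeLieC, ∀ u ∈ U, Z u ∈ U) → U = ⊥ ∨ U = ⊤ :=
      fun U hU => SymplecticTheta.eq_bot_or_top_of_stable H hn heff ψ hE H.hodgeLie hΘ hΘ𝔤 hskew
        fun X hX u hu => hU _ (by rw [hspan]; exact baseChange_mem_spanC hX) u hu
    have hC𝔊 : C ∈ H.hodgeLieC := by
      rw [hspan] at hB ⊢
      exact conjOp_mem_spanC hB hC
    obtain ⟨hP6, -⟩ := finrank_pieces_eq_of_weightOne H hn heff (m := 6) (by rw [hV]) hΘ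
    obtain ⟨𝔏, T, PT, QT, hmem𝔏, h𝔏br, h𝔏one, h𝔏irr, hT𝔏, hTT, hPT, hQT, -, hfinQT, hsum⟩ :=
      WeightOnePeirce.exists_leviInvolutionAlgebra H ψ hn heff hΘ le_rfl hbrC hΘC hirr hB hB0 hBP hBim hC hC𝔊 hmin
    refine ⟨hsimple, hP6, 𝔏, T, PT, QT, hmem𝔏, h𝔏br, h𝔏one, h𝔏irr, hT𝔏, hTT, hPT, hQT, by omega, by omega, ?_⟩
    -- `𝔏 = ⊤` would give `Lie Hg = 𝔰𝔭₁₂`, hence a rank-one raising operator in `𝔥_ℂ`, contradicting `rank B ≥ 3`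
    intro htop
    have hP0 : H.piece 1 0 ≠ ⊥ := fun h => by
      rw [h, finrank_bot] at hP6
      exact absurd hP6 (by norm_num)
    have hlevi : ∀ A : Module.End ℂ ↥(H.piece 1 0), ∃ Z ∈ spanC H.hodgeLie, ∀ p : ↥(H.piece 1 0),
        ((A p : ↥(H.piece 1 0)) : ℂ ⊗[ℚ] V) = Z p := fun A => by
      obtain ⟨Z, hZ, hAZ⟩ := (hmem𝔏 A).1 (htop ▸ Submodule.mem_top)
      exact ⟨Z, hspan ▸ hZ, hAZ⟩
    have hall := fun (Y : Module.End ℂ (ℂ ⊗[ℚ] V))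
        (hY : ∀ x y, ψ.form.baseChange ℂ (Y x) y + ψ.form.baseChange ℂ x (Y y) = 0) =>
      SymplecticThetaTen.mem_spanC_of_skew_of_levi H hn heff ψ hE H.hodgeLie hbr hΘ hΘ𝔤 hskew hP0 hlevi hY
    -- a rank-one raising `ψ_ℂ`-skew operator `Y v = ψ_ℂ(v, p₀) p₀`
    subst hn
    obtain ⟨p₀, hp₀P, hp₀0⟩ := (Submodule.ne_bot_iff _).1 hP0
    set ω := ψ.form.baseChange ℂ with hω
    have hωalt : ∀ x x', ω x x' = -ω x' x := fun x x' => by rw [hω, form_baseChange_swap_of_odd H odd_one ψ x' x]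
    have hωnd : ω.Nondegenerate := by rw [hω]; exact ψ.nondegenerate_baseChange
    have hPP : ∀ p ∈ H.piece 1 0, ∀ p' ∈ H.piece 1 0, ω p p' = 0 := fun p hp p' hp' =>
      ψ.form_piece_piece (p := 1) (p' := 1) (by norm_num) (by rw [sub_self]; exact hp) (by rw [sub_self]; exact hp')
    let Y : Module.End ℂ (ℂ ⊗[ℚ] V) := (ω.flip p₀).smulRight p₀
    have hYv : ∀ v, Y v = ω v p₀ • p₀ := fun v => rfl
    have hYskew : ∀ x y, ω (Y x) y + ω x (Y y) = 0 := fun x y => by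
      rw [hYv, hYv, map_smul, LinearMap.smul_apply, map_smul, smul_eq_mul, smul_eq_mul, hωalt p₀ y]
      ring
    have hY𝔥 : Y ∈ H.hodgeLieC := by rw [hspan]; exact hall Y hYskew
    have hYP : ∀ p ∈ H.piece 1 0, Y p = 0 := fun p hp => by rw [hYv, hPP p hp p₀ hp₀P, zero_smul]
    have hYim : ∀ v, Y v ∈ H.piece 1 0 := fun v => by rw [hYv]; exact Submodule.smul_mem _ _ hp₀P
    have hY0 : Y ≠ 0 := by
      intro h0
      obtain ⟨v, hv⟩ : ∃ v, ω v p₀ ≠ 0 := by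
        by_contra hno
        push Not at hno
        apply hp₀0
        refine hωnd.1 _ fun w => ?_
        rw [hωalt, hno w, neg_zero]
      have h := congrArg (fun X : Module.End ℂ (ℂ ⊗[ℚ] V) => X v) h0
      simp only [hYv, LinearMap.zero_apply, smul_eq_zero] at h
      rcases h with h | h
      · exact hv h
      · exact hp₀0 h
    have hYrk : Module.finrank ℂ (LinearMap.range Y) ≤ 1 := by
      have hle : LinearMap.range Y ≤ Submodule.span ℂ ({p₀} : Set (ℂ ⊗[ℚ] V)) := by
        rintro _ ⟨v, rfl⟩
        rw [hYv]
        exact Submodule.smul_mem _ _ (Submodule.mem_span_singleton_self p₀)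
      exact (Submodule.finrank_mono hle).trans ((finrank_span_le_card _).trans (by simp))
    have h := hmin Y hY𝔥 hY0 hYP hYim
    omega

end HodgeStructure

end Literature.AlgebraicGeometry.Motives
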